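import Literature.MathematicalPhysics.QuantumFieldTheory.Balaban1983to89.Node00.OpsYDelta2FormQ
import Literature.MathematicalPhysics.QuantumFieldTheory.Balaban1983to89.B9BackgroundsKLevelV1R
import Literature.MathematicalPhysics.QuantumFieldTheory.Balaban1983to89.B9PinGeometryKLevelV1B

/-!
# Guard adapters for the knit Sect.-D network «KD′» at the letters of record

[B9] T. Balaban, *Propagators for lattice gauge theories in a background field*, Commun. Math. Phys. **99** (1985) 389–434,
Sect. D (3.115)–(3.153) pp.418–426 with the small-field regime (3.35) p.396; [B-Avg] T. Balaban, *Averaging operations for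
lattice gauge theories*, Commun. Math. Phys. **98** (1985) 17–51, Prop. 2 p.26.

BOOKKEEPING ONLY (node00-def-Y, CASCADE-K «KE» input).  The knit Sect.-D network theorem
`Summit.…N06AtOpsYSectEStKnitSectDKDG.t312_t313_opsYSectESt_knit_KDG` (✓p794292) DISPLAYS three (3.35)-keyed laws of the
knit letters in the member-regime currency `bg9YR 𝔸 SU(N) R₁ R₂ x` of an abstract regime family `R₁ R₂` tied to print's
(3.35) class by the bridge `hRP1 : Reg335_R c α₀ U → 0 ≤ α₀ ∧ (bg9YP … x).Reg335 c35Y α₀ U`: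

* `hsymDK` — symmetry of `G_D ∕ G₁ ∕ 𝔊` (3.122), (3.128), (3.153);
* `hΔ2`    — symmetry of the knit residual form `Δ⁽²⁾` (3.134);
* `hUQG1K` — the unit `Q G₁ Q*` of (3.138) given `Δ₁ > 0`.

This file states each display VERBATIM at the record instance
`𝔏 := lettersYOfRecordV11K N θ M⋆ (resYOfRecordPK N θ M⋆)`, `𝔯 := resYOfRecordPK N θ M⋆` and closes it from `hRP1` and the
x-free knit numerics by the regime-keyed record laws of `Node00.OpsYDelta2FormQ`
(`lettersYOfRecordV11K_symmDG₁GG_PK_SU_threshK`, `resYOfRecordPK_Δ2_isSymmTr_SU_threshK`,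
`lettersYOfRecordV11K_isUnit_QGQOfQY_G₁_PK_SU_threshK`) at `c₀ := c35Y = 10`.  Nothing here is a discharge of N06; no new
mathematics. [cite: Balaban1985BackgroundPropagators, (3.122) p.420, (3.128) p.421, (3.134) p.422, (3.138) p.423, (3.153) p.426, (3.35) p.396]
[cite: Balaban1985Averaging, Prop. 2 p.26]
-/

noncomputable section

namespace Literature.MathematicalPhysics.QuantumFieldTheory.Balaban1983to89.Node00

open B6KLevelCensusIndexV1 (KIdx kGeo)
open B9PinMembersKLevelV1 (MemberY geo9Y)
open B9Thm311ReadingCoords (IsSymmTr PosDefTr)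
open B7Prop2SpecialUnitary (specialUnitaryUnits)
open B7Prop2Explicit (C0 c2')
open B9C2FormBoxRegimeY (Kpl)
open B9Eq316AveragingTransposeZd (alphaQ)
open B9Eq3115KnitLetterYOnto (kCol)
open B9B8AveragingJunction (parKnitY)
open B9BackgroundsKLevelV1P (bg9YP)
open B9BackgroundsKLevelV1R (RegFamY bg9YR)
open B9PinGeometryKLevelV1 (c35Y)
open B9PinGeometryKLevelV1B (c35Y_le_ten)
open OpsYQLetter (qKnitOfRecord qsKnitOfRecord)
open scoped Matrix Matrix.Norms.L2Operator

section KnitGuardAdaptersKD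

variable (N : ℕ) [Nonempty (Fin N)] (θ : Stage3Params) (Mstar : ℕ)
variable {R₁ R₂ : RegFamY θ.d₆ θ.ℓ₆ θ.hd' θ.hL' θ.b₀ θ.b₁ Mstar (Matrix (Fin N) (Fin N) ℂ)} {c : ℝ}

/-- «KD′»'s `hsymDK` display at the knit letters of record over the knit residual of record, closed from the regime bridge `hRP1`
and the x-free knit numerics (engine: `lettersYOfRecordV11K_symmDG₁GG_PK_SU_threshK` at `c₀ := c35Y`).
[cite: Balaban1985BackgroundPropagators, (3.122) p.420, (3.128) p.421, (3.153) p.426, (3.35) p.396] [cite: Balaban1985Averaging, Prop. 2 p.26] -/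
theorem hsymDK_knitRecord_of_RP1
    (hRP1 : ∀ (x : MemberY θ.d₆ θ.ℓ₆ θ.hd' θ.hL' θ.b₀ θ.b₁ Mstar) (α₀ : ℝ)
      (U : (bg9YR (Matrix (Fin N) (Fin N) ℂ) (specialUnitaryUnits (Fin N)) R₁ R₂ x).Cfg),
      (bg9YR (Matrix (Fin N) (Fin N) ℂ) (specialUnitaryUnits (Fin N)) R₁ R₂ x).Reg335 c α₀ U →
        0 ≤ α₀ ∧ (bg9YP (Matrix (Fin N) (Fin N) ℂ) (specialUnitaryUnits (Fin N)) x).Reg335 c35Y α₀ U)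
    {M12 a12 aK α₀' : ℝ} (hα' : 0 < α₀') (hα3 : C0 (θ.d₆ + 1) * α₀' ≤ 1 / 3) (hα4 : 4 * α₀' ≤ c2' (θ.d₆ + 1) (θ.ℓ₆ + 1))
    (hexp : Real.exp (4 * (800 * (((θ.d₆ + 1 : ℕ) : ℝ) + 1) ^ 2 * (((θ.d₆ + 1 : ℕ) : ℝ) + 4)) * α₀') < 2)
    (hKplK : ∀ (i : KIdx θ.d₆ θ.ℓ₆ θ.hd' θ.hL' θ.b₀ θ.b₁) (a : ℝ), 0 ≤ a → a ≤ aK → Kpl i a * (kGeo i).L ^ 4 < α₀')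
    (h12 : 0 ≤ a12) (h12K : a12 ≤ aK) :
    ∀ x : MemberY θ.d₆ θ.ℓ₆ θ.hd' θ.hL' θ.b₀ θ.b₁ Mstar, M12 ≤ (geo9Y x).M → ∀ α₀ : ℝ, 0 < α₀ → (geo9Y x).M * α₀ ≤ a12 →
      ∀ U : (bg9YR (Matrix (Fin N) (Fin N) ℂ) (specialUnitaryUnits (Fin N)) R₁ R₂ x).Cfg,
        (bg9YR (Matrix (Fin N) (Fin N) ℂ) (specialUnitaryUnits (Fin N)) R₁ R₂ x).Reg335 c α₀ U →
          IsSymmTr (fun _ => (1 : ℝ)) ((lettersYOfRecordV11K N θ Mstar (resYOfRecordPK N θ Mstar) x).GD U) ∧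
            IsSymmTr (fun _ => (1 : ℝ)) ((lettersYOfRecordV11K N θ Mstar (resYOfRecordPK N θ Mstar) x).G₁ U) ∧
              IsSymmTr (fun _ => (1 : ℝ)) ((lettersYOfRecordV11K N θ Mstar (resYOfRecordPK N θ Mstar) x).GG U) :=
  fun x _ α₀ hα ha U hU =>
    lettersYOfRecordV11K_symmDG₁GG_PK_SU_threshK N θ Mstar x c35Y_le_ten hα' hα3 hα4 hexp (hKplK x.toKIdx a12 h12 h12K)
      α₀ hα ha U (hRP1 x α₀ U hU).2

/-- «KD′»'s `hΔ2` display at the knit residual of record `Δ⁽²⁾` of (3.134), closed from `hRP1` and the x-free knit numerics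
(engine: `resYOfRecordPK_Δ2_isSymmTr_SU_threshK` at `c₀ := c35Y`).
[cite: Balaban1985BackgroundPropagators, (3.134) p.422, Thm 3.11 p.416, (3.35) p.396] [cite: Balaban1985Averaging, Prop. 2 p.26] -/
theorem hΔ2_knitRecord_of_RP1
    (hRP1 : ∀ (x : MemberY θ.d₆ θ.ℓ₆ θ.hd' θ.hL' θ.b₀ θ.b₁ Mstar) (α₀ : ℝ)
      (U : (bg9YR (Matrix (Fin N) (Fin N) ℂ) (specialUnitaryUnits (Fin N)) R₁ R₂ x).Cfg),
      (bg9YR (Matrix (Fin N) (Fin N) ℂ) (specialUnitaryUnits (Fin N)) R₁ R₂ x).Reg335 c α₀ U →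
        0 ≤ α₀ ∧ (bg9YP (Matrix (Fin N) (Fin N) ℂ) (specialUnitaryUnits (Fin N)) x).Reg335 c35Y α₀ U)
    {M12 a12 aK α₀' : ℝ} (hα' : 0 < α₀') (hα3 : C0 (θ.d₆ + 1) * α₀' ≤ 1 / 3) (hα4 : 4 * α₀' ≤ c2' (θ.d₆ + 1) (θ.ℓ₆ + 1))
    (hexp : Real.exp (4 * (800 * (((θ.d₆ + 1 : ℕ) : ℝ) + 1) ^ 2 * (((θ.d₆ + 1 : ℕ) : ℝ) + 4)) * α₀') < 2)
    (hKplK : ∀ (i : KIdx θ.d₆ θ.ℓ₆ θ.hd' θ.hL' θ.b₀ θ.b₁) (a : ℝ), 0 ≤ a → a ≤ aK → Kpl i a * (kGeo i).L ^ 4 < α₀')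
    (h12 : 0 ≤ a12) (h12K : a12 ≤ aK) :
    ∀ x : MemberY θ.d₆ θ.ℓ₆ θ.hd' θ.hL' θ.b₀ θ.b₁ Mstar, M12 ≤ (geo9Y x).M → ∀ α₀ : ℝ, 0 < α₀ → (geo9Y x).M * α₀ ≤ a12 →
      ∀ U : (bg9YR (Matrix (Fin N) (Fin N) ℂ) (specialUnitaryUnits (Fin N)) R₁ R₂ x).Cfg,
        (bg9YR (Matrix (Fin N) (Fin N) ℂ) (specialUnitaryUnits (Fin N)) R₁ R₂ x).Reg335 c α₀ U →
          IsSymmTr (fun _ => (1 : ℝ)) ((resYOfRecordPK N θ Mstar x).Δ2 U) :=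
  fun x _ α₀ hα ha U hU =>
    resYOfRecordPK_Δ2_isSymmTr_SU_threshK N θ Mstar x c35Y_le_ten hα' hα3 hα4 hexp (hKplK x.toKIdx a12 h12 h12K)
      α₀ hα ha U (hRP1 x α₀ U hU).2

/-- «KD′»'s `hUQG1K` display — the unit `Q G₁ Q*` of (3.138) at the knit letters of record given `Δ₁ > 0` — closed from `hRP1`
and the x-free knit numerics (engine: `lettersYOfRecordV11K_isUnit_QGQOfQY_G₁_PK_SU_threshK` at `c₀ := c35Y`; the (3.36)
hypothesis of the display is not needed and is discarded).
[cite: Balaban1985BackgroundPropagators, (3.132) p.422, (3.138) p.423, p.420, (3.35) p.396] [cite: Balaban1985Averaging, (139)–(147) pp.39–40] -/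
theorem hUQG1K_knitRecord_of_RP1
    (hRP1 : ∀ (x : MemberY θ.d₆ θ.ℓ₆ θ.hd' θ.hL' θ.b₀ θ.b₁ Mstar) (α₀ : ℝ)
      (U : (bg9YR (Matrix (Fin N) (Fin N) ℂ) (specialUnitaryUnits (Fin N)) R₁ R₂ x).Cfg),
      (bg9YR (Matrix (Fin N) (Fin N) ℂ) (specialUnitaryUnits (Fin N)) R₁ R₂ x).Reg335 c α₀ U →
        0 ≤ α₀ ∧ (bg9YP (Matrix (Fin N) (Fin N) ℂ) (specialUnitaryUnits (Fin N)) x).Reg335 c35Y α₀ U)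
    {M12 a12 aK α₀' : ℝ} (hα' : 0 < α₀') (hαQ : α₀' ≤ alphaQ (θ.d₆ + 1) (θ.ℓ₆ + 1))
    (hsmall : kCol (θ.d₆ + 1) (θ.ℓ₆ + 1) * α₀' < 1)
    (hKplK : ∀ (i : KIdx θ.d₆ θ.ℓ₆ θ.hd' θ.hL' θ.b₀ θ.b₁) (a : ℝ), 0 ≤ a → a ≤ aK → Kpl i a * (kGeo i).L ^ 4 < α₀')
    (h12 : 0 ≤ a12) (h12K : a12 ≤ aK) :
    ∀ x : MemberY θ.d₆ θ.ℓ₆ θ.hd' θ.hL' θ.b₀ θ.b₁ Mstar, M12 ≤ (geo9Y x).M → ∀ α₀ : ℝ, 0 < α₀ → (geo9Y x).M * α₀ ≤ a12 →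
      ∀ U : (bg9YR (Matrix (Fin N) (Fin N) ℂ) (specialUnitaryUnits (Fin N)) R₁ R₂ x).Cfg,
        (bg9YR (Matrix (Fin N) (Fin N) ℂ) (specialUnitaryUnits (Fin N)) R₁ R₂ x).Reg335 c α₀ U →
          (bg9YR (Matrix (Fin N) (Fin N) ℂ) (specialUnitaryUnits (Fin N)) R₁ R₂ x).Reg336 c α₀ U →
            PosDefTr (fun _ => (1 : ℝ))
                (deltaOneQY x.toKIdx (qKnitOfRecord N θ x.toKIdx) (qsKnitOfRecord N θ x.toKIdx) (parKnitY x.toKIdx)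
                  (GpPhysY x.toKIdx (parKnitY x.toKIdx)) ((resYOfRecordPK N θ Mstar x).Δ2) U) →
              IsUnit
                (QGQOfQY x.toKIdx (qKnitOfRecord N θ x.toKIdx) (qsKnitOfRecord N θ x.toKIdx)
                  (G1QY x.toKIdx (qKnitOfRecord N θ x.toKIdx) (qsKnitOfRecord N θ x.toKIdx) (parKnitY x.toKIdx)
                    (GpPhysY x.toKIdx (parKnitY x.toKIdx)) ((resYOfRecordPK N θ Mstar x).Δ2))
                  U) :=
  fun x _ α₀ hα ha U hU _ hΔ1 =>
    lettersYOfRecordV11K_isUnit_QGQOfQY_G₁_PK_SU_threshK N θ Mstar x c35Y_le_ten hα' hαQ (hKplK x.toKIdx a12 h12 h12K) hsmall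
      α₀ hα ha U (hRP1 x α₀ U hU).2 hΔ1

end KnitGuardAdaptersKD

end Literature.MathematicalPhysics.QuantumFieldTheory.Balaban1983to89.Node00

end
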